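import Literature.Barriers.NavierStokesRegularity.SharpLpLinftyNonuniqueness
import Literature.Barriers.NavierStokesRegularity.SharpLpLinftyNonuniquenessIteration
import Literature.Analysis.FluidPDE.TorusWeakNSGluing
import Literature.Analysis.FluidPDE.NavierStokesConcentrationTools
import Literature.Analysis.FluidPDE.NavierStokesConcentration
import Literature.Analysis.FluidPDE.NavierStokesConcentrationCorrectorProofs
import Literature.Analysis.FluidPDE.CLConvexIntegration
import Literature.Analysis.FunctionSpaces.TorusFourierModes
import HarnessLib

/-!
# Cheskidov–Luo 2022, Thm. 1.6 from Thm. 1.7: the printed deduction (§2.6), proved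

Sibling proof file (D-0021, no definitions) of the barrier entry
`Literature/Barriers/NavierStokesRegularity/SharpLpLinftyNonuniqueness`. It PROVES

* `SharpLpLinftyNonuniqueness_of_mainTheorem :
    CheskidovLuo2022MainTheorem → SharpLpLinftyNonuniqueness`,

i.e. the barrier fact (A. Cheskidov, X. Luo, *Sharp nonuniqueness for the Navier–Stokes
equations*, Invent. Math. 229 (2022), Thm. 1.6) from the vendored main theorem (Thm. 1.7,
`CheskidovLuo2022MainTheorem`, same file), following the printed proof (§2.6, p. 11 of the held
arXiv text 2009.06596): given a weak solution `u ∈ L^p_t L^∞_x` with an interval of regularity,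
pick a time `a` inside it, build a smooth divergence-free zero-mean field `ṽ` on `[0, T - a]`
which agrees with `u(· + a)` near `0` and equals a large multiple `K W` of a fixed shear mode
later ("`‖ṽ - v‖ ≥ 1`, `‖ṽ‖_{L^p L²} ≥ 1 + ‖v(0)‖₂`"), apply Thm. 1.7 to `ṽ` (`ε = 1`), and glue
the resulting weak solution `w` (datum `ṽ(0) = u(a)`) to `u` at time `a`
(`Torus.IsWeakNSSolutionWithDataOn.glue`, file `Literature/Analysis/FluidPDE/TorusWeakNSGluing`:
"the glued solution is still a weak solution due the smoothness of both `v` and `ũ` near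
`t = a`"). The glued field is a weak solution with the same datum in `L^p_t L^∞_x`; it differs
from `u` and is not Leray–Hopf because on the late time interval `J` (length `L`) its slices are
`1`-close in `L^p_t L^∞_x` to `K W`, whence `K ‖W‖₂ L ≤ ∫_J ‖w(s)‖₂ ds + L + 1`, while
`∫_J ‖w(s)‖₂ ds` is bounded by `T + ‖u‖²_{L²ₜₓ}` if the glued field coincided with `u`, and by
`(1 + ‖u₀‖₂²) L` if it were Leray–Hopf ("Leray–Hopf solutions must have non-increasing `L²` norm")
— both impossible for the chosen `K` (`SharpLpLinftyNonuniqueness.core_contradiction`; the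
estimates are run with lower Lebesgue integrals in `[0, ∞]`, so that no measurability in time of
`s ↦ ‖w(s) - K W‖_∞` is needed).

Auxiliary results (all proved): weakly divergence-free smooth fields on `T^d` are divergence
free (`IsWeaklyDivFree.isDivFree_of_isSmooth`); a.e.-in-time incompressibility / zero mean
become pointwise on a slab of joint smoothness; time translation of joint smoothness; the shear
mode `W = Re(e_{e₁} ⊗ e₀)` (smooth, divergence free, zero mean, bounded by `1`, `‖W‖₂ > 0`).

## Reduction to the convex-integration step (Prop. 4.1)

With the accepted reductions of Thm. 1.7 — `CheskidovLuo2022MainTheorem_of_mainIteration`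
(§2.6, file `SharpLpLinftyNonuniquenessIteration`), `Torus.CheskidovLuo2022MainIteration_of_steps`
(Prop. 2.2 from Props. 3.1 and 4.1, file `NavierStokesReynoldsSteps`),
`Torus.CheskidovLuo2022Concentration_of_corrector` (Prop. 3.1, file `NavierStokesConcentration`)
and the proved corrector fact `Torus.CheskidovLuo2022Corrector_holds` (§3.1, Prop. 3.2, file
`NavierStokesConcentrationCorrectorProofs`) — the barrier fact is reduced to the single remaining
named fact of the chain, the convex-integration step Prop. 4.1
(`Torus.CheskidovLuo2022ConvexIntegration`, §§4–5 of the paper), in every dimension `Fin n`: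

* `SharpLpLinftyNonuniqueness_of_convexIntegration :
    (∀ n, Torus.CheskidovLuo2022ConvexIntegration (d := Fin n)) → SharpLpLinftyNonuniqueness`.

The discharge `SharpLpLinftyNonuniqueness_holds` is the one-line application of this
theorem to the proved convex-integration step `Torus.CheskidovLuo2022ConvexIntegration_holds`
(Prop. 4.1 with the parameter choice of §5.1, file `CLConvexIntegration`): CL22 Thm. 1.6 is
thereby PROVED in the tree.

## References

* A. Cheskidov, X. Luo, Invent. Math. 229 (2022), 987–1054; arXiv:2009.06596, Thm. 1.6, Thm. 1.7,
  Prop. 2.2, Prop. 3.1, Prop. 4.1 and §2.6 (proof of Thm. 1.6). [`CheskidovLuo2022`]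
-/

noncomputable section

open MeasureTheory Set Filter Topology Function UnitAddTorus
open scoped ENNReal NNReal InnerProductSpace ContDiff

namespace Literature.Barriers.NavierStokesRegularity

open Literature.Analysis Literature.Analysis.FunctionSpaces Literature.Analysis.FluidPDE

/-! ## Slab facts on `T^d` -/

section Slab

variable {d : Type*} [Fintype d] [DecidableEq d]

/-- **A weakly divergence-free smooth field on `T^d` is divergence free**: testing
`∫⟪f, ∇θ⟫ = 0` with `θ = div f` and integrating by parts
(`Torus.integral_inner_gradient_eq_neg_integral_mul_divergence_holds`) gives `∫ (div f)² = 0`,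
so the continuous `div f` vanishes identically. [folklore] -/
theorem _root_.Literature.Analysis.FunctionSpaces.Torus.IsWeaklyDivFree.isDivFree_of_isSmooth
    {f : UnitAddTorus d → EuclideanSpace ℝ d} (hw : Torus.IsWeaklyDivFree f) (hf : Torus.IsSmooth f) :
    Torus.IsDivFree f := by
  have hds : Torus.IsSmooth (Torus.divergence f) := hf.divergence
  have h0 : ∫ x, Torus.divergence f x * Torus.divergence f x = 0 := by
    have h := hw _ hds
    rw [Torus.integral_inner_gradient_eq_neg_integral_mul_divergence_holds hf hds, neg_eq_zero] at h
    exact h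
  have hint : Integrable (fun x => Torus.divergence f x * Torus.divergence f x) volume :=
    (hds.continuous.mul hds.continuous).integrable_unitAddTorus
  have hae : (fun x => Torus.divergence f x * Torus.divergence f x) =ᵐ[volume] 0 :=
    (integral_eq_zero_iff_of_nonneg (fun x => mul_self_nonneg _) hint).1 h0
  have heq : (fun x => Torus.divergence f x * Torus.divergence f x) = fun _ => (0 : ℝ) :=
    (Continuous.ae_eq_iff_eq volume (hds.continuous.mul hds.continuous) continuous_const).1 hae
  intro x
  have hx := congrFun heq x
  simpa using hx

omit [Fintype d] [DecidableEq d] in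
/-- A jointly continuous scalar field on `S × T^d` has slices `t ↦ g t x` continuous on `S` for
every `x`. [folklore] -/
theorem continuousOn_slice_time {S : Set ℝ} {g : ℝ → UnitAddTorus d → ℝ}
    (hg : ContinuousOn (Torus.stLift g) (S ×ˢ univ)) (x : UnitAddTorus d) :
    ContinuousOn (fun t => g t x) S := by
  obtain ⟨y, rfl⟩ := Torus.proj_surjective x
  have h : (fun t => g t (Torus.proj y)) = Torus.stLift g ∘ fun t => (t, y) := by
    funext t
    rfl
  rw [h]
  exact hg.comp (continuous_id.prodMk continuous_const).continuousOn fun t ht => ⟨ht, mem_univ _⟩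

/-- **Incompressibility at every time of a smooth slab from a.e. time.** If `u` is jointly
smooth on `[a, b] × T^d`, `a < b`, and weakly divergence free for a.e. `t ∈ [a, b]`, then `u(t)`
is divergence free for every `t ∈ [a, b]` (`div u(t) x` is continuous in `t` and vanishes for
a.e. `t`, `MeasureTheory.Measure.eqOn_of_ae_eq`). [folklore] -/
theorem isDivFree_of_ae_of_isSmoothSpaceTimeOn {u : ℝ → UnitAddTorus d → EuclideanSpace ℝ d}
    {a b : ℝ} (hab : a < b) (hu : Torus.IsSmoothSpaceTimeOn (Icc a b) u)
    (hae : ∀ᵐ t ∂(volume.restrict (Icc a b)), Torus.IsWeaklyDivFree (u t)) :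
    ∀ t ∈ Icc a b, Torus.IsDivFree (u t) := by
  have hdiv : ∀ᵐ t ∂(volume.restrict (Icc a b)), Torus.IsDivFree (u t) := by
    filter_upwards [hae, ae_restrict_mem measurableSet_Icc] with t ht htI
    exact ht.isDivFree_of_isSmooth (hu.isSmooth_slice htI)
  have hsm := hu.divergence (uniqueDiffOn_Icc hab)
  intro t ht x
  have hc : ContinuousOn (fun s => Torus.divergence (u s) x) (Icc a b) :=
    continuousOn_slice_time hsm.continuousOn_stLift x
  have hae' : (fun s => Torus.divergence (u s) x) =ᵐ[volume.restrict (Icc a b)] fun _ => (0 : ℝ) := by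
    filter_upwards [hdiv] with s hs
    exact hs x
  have h := Measure.eqOn_of_ae_eq hae' hc continuousOn_const (by
    rw [interior_Icc, closure_Ioo hab.ne])
  exact h ht

omit [DecidableEq d] in
/-- **Zero mean at every time of a smooth slab from a.e. time** (`t ↦ ∫ u(t)` is continuous on
the slab, `Torus.IsSmoothSpaceTimeOn.continuousOn_integral`). [folklore] -/
theorem hasZeroMean_of_ae_of_isSmoothSpaceTimeOn {F : Type*} [NormedAddCommGroup F] [NormedSpace ℝ F]
    [CompleteSpace F] {u : ℝ → UnitAddTorus d → F}
    {a b : ℝ} (hab : a < b) (hu : Torus.IsSmoothSpaceTimeOn (Icc a b) u)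
    (hae : ∀ᵐ t ∂(volume.restrict (Icc a b)), Torus.HasZeroMean (u t)) :
    ∀ t ∈ Icc a b, Torus.HasZeroMean (u t) := by
  have hc : ContinuousOn (fun t => ∫ x, u t x) (Icc a b) := hu.continuousOn_integral (convex_Icc a b)
  have h := Measure.eqOn_of_ae_eq (f := fun t => ∫ x, u t x) (g := fun _ => (0 : F)) hae hc
    continuousOn_const (by rw [interior_Icc, closure_Ioo hab.ne])
  intro t ht
  exact h ht

omit [DecidableEq d] in
/-- **Time translation of joint smoothness**: if `u` is jointly smooth on `[a + c, b + c] × T^d`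
then `s ↦ u(s + c)` is jointly smooth on `[a, b] × T^d`. [folklore] -/
theorem isSmoothSpaceTimeOn_comp_add_right {F : Type*} [NormedAddCommGroup F] [NormedSpace ℝ F]
    {u : ℝ → UnitAddTorus d → F} {a b c : ℝ} (hu : Torus.IsSmoothSpaceTimeOn (Icc (a + c) (b + c)) u) :
    Torus.IsSmoothSpaceTimeOn (Icc a b) (fun s => u (s + c)) := by
  change ContDiffOn ℝ ∞ (Torus.stLift fun s => u (s + c)) (Icc a b ×ˢ univ)
  rw [FluidPDE.Torus.stLift_comp_add_right]
  refine hu.comp (FluidPDE.Torus.contDiff_prodMap_add_right c).contDiffOn fun p hp => ?_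
  obtain ⟨h1, -⟩ := mem_prod.1 hp
  exact ⟨⟨by simp only [Prod.map_fst]; linarith [h1.1], by simp only [Prod.map_fst]; linarith [h1.2]⟩,
    mem_univ _⟩

end Slab

/-! ## The shear mode `W` -/

section ShearMode

variable {d : Type*} [Fintype d] [DecidableEq d]

omit [DecidableEq d] in
/-- A single real Fourier mode `Re(e_k ⊗ z)` with `k ≠ 0` has zero mean on `T^d`
(`∫ e_k = 0`, `Torus.integral_mFourier`). [folklore] -/
theorem hasZeroMean_realTrigPoly_singleton {k : d → ℤ} (hk : k ≠ 0) (c : (d → ℤ) → EuclideanSpace ℂ d) :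
    Torus.HasZeroMean (Torus.realTrigPoly {k} c) := by
  unfold Torus.HasZeroMean
  have h1 : (fun x => Torus.realTrigPoly {k} c x) = fun x => EuclideanSpace.realPart (mFourier k x • c k) :=
    funext fun x => Torus.realTrigPoly_singleton_apply k c x
  have hint : Integrable (fun x : UnitAddTorus d => mFourier k x • c k) volume :=
    ((mFourier k).continuous.smul continuous_const).integrable_unitAddTorus
  rw [h1, ContinuousLinearMap.integral_comp_comm _ hint, integral_smul_const, Torus.integral_mFourier,
    if_neg hk, zero_smul, map_zero]

omit [DecidableEq d] in
/-- A single real Fourier mode at `x = 0` equals `Re z`. [folklore] -/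
theorem realTrigPoly_singleton_apply_zero (k : d → ℤ) (c : (d → ℤ) → EuclideanSpace ℂ d) :
    Torus.realTrigPoly {k} c 0 = EuclideanSpace.realPart (c k) := by
  rw [Torus.realTrigPoly_singleton_apply]
  have h : mFourier k (0 : UnitAddTorus d) = 1 := by
    simp only [mFourier, ContinuousMap.coe_mk, Pi.zero_apply, fourier_eval_zero, Finset.prod_const_one]
  rw [h, one_smul]

omit [DecidableEq d] in
/-- A continuous field on `T^d` which does not vanish identically has positive `L²` norm
(continuous functions agreeing a.e. agree). [folklore] -/
theorem eLpNorm_pos_of_continuous_of_ne_zero {f : UnitAddTorus d → EuclideanSpace ℝ d}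
    (hf : Continuous f) {x₀ : UnitAddTorus d} (hx₀ : f x₀ ≠ 0) (p : ℝ≥0∞) (hp : p ≠ 0) :
    0 < eLpNorm f p volume := by
  refine pos_iff_ne_zero.2 fun h => hx₀ ?_
  have hae : f =ᵐ[volume] 0 := (eLpNorm_eq_zero_iff hf.aestronglyMeasurable hp).1 h
  have heq : f = 0 := (Continuous.ae_eq_iff_eq volume hf continuous_const).1 hae
  rw [heq]
  rfl

end ShearMode

/-! ## Measure-theoretic helpers: translations, `L²` slice norms, the core estimate -/

section Helpers

variable {d : Type*} [Fintype d]

omit [Fintype d] in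
/-- `x ≤ 1 + x ^ p` in `[0, ∞]` for `1 ≤ p`. [folklore] -/
theorem ennreal_le_one_add_rpow (x : ℝ≥0∞) {p : ℝ} (hp : 1 ≤ p) : x ≤ 1 + x ^ p := by
  rcases le_total x 1 with hx | hx
  · exact hx.trans le_self_add
  · calc x = x ^ (1 : ℝ) := (ENNReal.rpow_one x).symm
      _ ≤ x ^ p := ENNReal.rpow_le_rpow_of_exponent_le hx hp
      _ ≤ 1 + x ^ p := le_add_self

omit [Fintype d] in
/-- `‖f‖_{L²}^2 = ∫⁻ ‖f‖ₑ²` (real exponent form). [folklore] -/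
theorem eLpNorm_two_rpow_two {α : Type*} {m : MeasurableSpace α} {μ : Measure α}
    {E : Type*} [NormedAddCommGroup E] (f : α → E) :
    eLpNorm f 2 μ ^ (2 : ℝ) = ∫⁻ x, ‖f x‖ₑ ^ 2 ∂μ := by
  rw [eLpNorm_eq_lintegral_rpow_enorm_toReal two_ne_zero ENNReal.ofNat_ne_top, ENNReal.toReal_ofNat,
    ← ENNReal.rpow_mul]
  norm_num

omit [Fintype d] in
/-- Transport of an a.e. statement along `s ↦ s + a`: if `P` holds a.e. on `(c₁ + a, c₂ + a)` then
`P (· + a)` holds a.e. on `(c₁, c₂)`. [folklore] -/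
theorem ae_restrict_Ioo_comp_add_right {c₁ c₂ a : ℝ} {P : ℝ → Prop}
    (h : ∀ᵐ t ∂(volume.restrict (Ioo (c₁ + a) (c₂ + a))), P t) :
    ∀ᵐ s ∂(volume.restrict (Ioo c₁ c₂)), P (s + a) := by
  have h2 := FluidPDE.ae_restrict_Ioo_comp_sub_right (-a) h
  simp only [sub_neg_eq_add] at h2
  have hset : Ioo (c₁ + a + -a) (c₂ + a + -a) = Ioo c₁ c₂ := by
    rw [add_neg_cancel_right, add_neg_cancel_right]
  rwa [hset] at h2

omit [Fintype d] in
/-- Change of variables `s ↦ s + a` in a lower integral over an interval: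
`∫⁻_{(c₁, c₂)} g(s + a) ds = ∫⁻_{(c₁ + a, c₂ + a)} g`. [folklore] -/
theorem setLIntegral_Ioo_comp_add_right (g : ℝ → ℝ≥0∞) (c₁ c₂ a : ℝ) :
    ∫⁻ s in Ioo c₁ c₂, g (s + a) = ∫⁻ t in Ioo (c₁ + a) (c₂ + a), g t := by
  have h := FluidPDE.setLIntegral_Ioo_comp_sub_right g (c₁ + a) (c₂ + a) (-a)
  simp only [sub_neg_eq_add, add_neg_cancel_right] at h
  exact h

/-- **Time-measurability of the `L²` slice norm** `s ↦ ‖w(s)‖_{L²(T^d)}` of a field which is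
space–time measurable on `S × T^d` (Tonelli). [folklore] -/
theorem aemeasurable_eLpNorm_two_slice {S : Set ℝ} {w : ℝ → UnitAddTorus d → EuclideanSpace ℝ d}
    (hm : AEStronglyMeasurable (Torus.stLift w) (volume.restrict (S ×ˢ univ))) :
    AEMeasurable (fun s => eLpNorm (w s) 2 volume) (volume.restrict S) := by
  have hF := Torus.aestronglyMeasurable_uncurry_of_stLift_prod hm
  have h1 : AEMeasurable (fun s => ∫⁻ x, ‖w s x‖ₑ ^ (2 : ℝ)) (volume.restrict S) :=
    (hF.aemeasurable.enorm.pow_const _).lintegral_prod_right'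
  have heq : (fun s => eLpNorm (w s) 2 volume) = fun s => (∫⁻ x, ‖w s x‖ₑ ^ (2 : ℝ)) ^ (1 / (2 : ℝ)) := by
    funext s
    rw [eLpNorm_eq_lintegral_rpow_enorm_toReal two_ne_zero ENNReal.ofNat_ne_top, ENNReal.toReal_ofNat]
  rw [heq]
  exact h1.pow_const _

/-- **The core estimate.** Let `w(s)`, `s ∈ J` (`|J| = L`), be slices in `L^∞(T^d)` whose `L²`
norms are measurable in `s` with `∫⁻_J ‖w(s)‖₂ ds ≤ B`, and suppose the closeness
`∫⁻_J ‖w(s) - K W‖_∞^p ds ≤ 1` (`p ≥ 1`) to the multiple `K W` of a bounded field `W` with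
`‖W‖₂ > 0`. Then `K ‖W‖₂ L ≤ B + L + 1`: indeed `K‖W‖₂ ≤ ‖w(s)‖₂ + ‖w(s) - KW‖₂ ≤ ‖w(s)‖₂ +
‖w(s) - KW‖_∞` slice-wise, and `∫⁻_J g ≤ ∫⁻_J (1 + g^p) ≤ L + 1` for the (possibly non-measurable
in `s`) function `g(s) = ‖w(s) - KW‖_∞` (lower Lebesgue integrals, `lintegral_add_left'`). Stated
as the contradiction it yields when `K` is chosen with `B + L + 1 < K ‖W‖₂ L`
(Cheskidov–Luo 2022, §2.6, the two displayed estimates in the proof of Thm. 1.6). [folklore] -/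
theorem core_contradiction {w : ℝ → UnitAddTorus d → EuclideanSpace ℝ d}
    {W : UnitAddTorus d → EuclideanSpace ℝ d} {J : Set ℝ} {p K L B : ℝ} (hp : 1 ≤ p) (hK : 0 ≤ K)
    (hL : 0 ≤ L) (hB : 0 ≤ B) (hJ : volume J = ENNReal.ofReal L) (hW : MemLp W ∞ volume)
    (hW2 : eLpNorm W 2 volume ≠ ⊤)
    (hwm : AEMeasurable (fun s => eLpNorm (w s) 2 volume) (volume.restrict J))
    (hguard : ∀ᵐ s ∂(volume.restrict J), MemLp (w s) ∞ volume)
    (hclose : ∫⁻ s in J, ‖(eLpNorm (w s - K • W) ∞ volume).toReal‖ₑ ^ p ≤ 1)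
    (hbound : ∫⁻ s in J, eLpNorm (w s) 2 volume ≤ ENNReal.ofReal B)
    (hlt : B + L + 1 < K * (eLpNorm W 2 volume).toReal * L) : False := by
  set W2 : ℝ≥0∞ := eLpNorm W 2 volume with hW2_def
  set G : ℝ → ℝ := fun s => (eLpNorm (w s - K • W) ∞ volume).toReal with hG
  -- slice-wise: `K ‖W‖₂ ≤ ‖w s‖₂ + ‖G s‖ₑ`
  have hslice : ∀ᵐ s ∂(volume.restrict J), ENNReal.ofReal K * W2 ≤ eLpNorm (w s) 2 volume + ‖G s‖ₑ := by
    filter_upwards [hguard] with s hws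
    have hKW : AEStronglyMeasurable (K • W) volume := hW.1.const_smul K
    have hdiff : MemLp (w s - K • W) ∞ volume := hws.sub (hW.const_smul K)
    have e1 : eLpNorm (K • W) 2 volume = ENNReal.ofReal K * W2 := by
      rw [eLpNorm_const_smul, Real.enorm_eq_ofReal hK]
    have e2 : eLpNorm (K • W) 2 volume ≤ eLpNorm (K • W - w s) 2 volume + eLpNorm (w s) 2 volume := by
      have h := eLpNorm_add_le (μ := volume) (hKW.sub hws.1) hws.1 one_le_two (p := 2)
      rwa [sub_add_cancel] at h
    have e3 : eLpNorm (K • W - w s) 2 volume = eLpNorm (w s - K • W) 2 volume := eLpNorm_sub_comm _ _ _ _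
    have e4 : eLpNorm (w s - K • W) 2 volume ≤ eLpNorm (w s - K • W) ∞ volume :=
      eLpNorm_le_eLpNorm_of_exponent_le le_top (hws.1.sub hKW)
    have e5 : eLpNorm (w s - K • W) ∞ volume = ‖G s‖ₑ := by
      rw [hG, Real.enorm_eq_ofReal ENNReal.toReal_nonneg, ENNReal.ofReal_toReal hdiff.eLpNorm_ne_top]
    calc ENNReal.ofReal K * W2 = eLpNorm (K • W) 2 volume := e1.symm
      _ ≤ eLpNorm (K • W - w s) 2 volume + eLpNorm (w s) 2 volume := e2
      _ ≤ ‖G s‖ₑ + eLpNorm (w s) 2 volume := by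
          rw [e3]
          exact add_le_add (e4.trans_eq e5) le_rfl
      _ = eLpNorm (w s) 2 volume + ‖G s‖ₑ := add_comm _ _
  -- integrate over `J`
  have i1 : ENNReal.ofReal K * W2 * volume J ≤ (∫⁻ s in J, eLpNorm (w s) 2 volume) + ∫⁻ s in J, ‖G s‖ₑ := by
    calc ENNReal.ofReal K * W2 * volume J = ∫⁻ _ in J, ENNReal.ofReal K * W2 := by
          rw [setLIntegral_const]
      _ ≤ ∫⁻ s in J, (eLpNorm (w s) 2 volume + ‖G s‖ₑ) := lintegral_mono_ae hslice
      _ = (∫⁻ s in J, eLpNorm (w s) 2 volume) + ∫⁻ s in J, ‖G s‖ₑ := lintegral_add_left' hwm _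
  have i2 : ∫⁻ s in J, ‖G s‖ₑ ≤ volume J + 1 := by
    calc ∫⁻ s in J, ‖G s‖ₑ ≤ ∫⁻ s in J, (1 + ‖G s‖ₑ ^ p) := lintegral_mono fun s => ennreal_le_one_add_rpow _ hp
      _ = (∫⁻ _ in J, (1 : ℝ≥0∞)) + ∫⁻ s in J, ‖G s‖ₑ ^ p := lintegral_add_left measurable_const _
      _ ≤ volume J + 1 := by
          rw [setLIntegral_const, one_mul]
          exact add_le_add le_rfl hclose
  have i3 : ENNReal.ofReal K * W2 * ENNReal.ofReal L ≤ ENNReal.ofReal B + (ENNReal.ofReal L + 1) := by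
    rw [← hJ]
    exact i1.trans (add_le_add hbound i2)
  -- back to real numbers
  have hW2r : W2 = ENNReal.ofReal W2.toReal := (ENNReal.ofReal_toReal hW2).symm
  rw [hW2r, ← ENNReal.ofReal_mul hK, ← ENNReal.ofReal_mul (mul_nonneg hK ENNReal.toReal_nonneg),
    ← ENNReal.ofReal_one, ← ENNReal.ofReal_add hL zero_le_one, ← ENNReal.ofReal_add hB (by positivity),
    ENNReal.ofReal_le_ofReal_iff (by positivity)] at i3
  linarith

end Helpers

/-! ## The reduction of Thm. 1.6 to Thm. 1.7 -/

section Assembly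

/-- **Cheskidov–Luo 2022, Thm. 1.6 from Thm. 1.7** (the deduction printed in §2.6, proved): the
main theorem `CheskidovLuo2022MainTheorem` (Thm. 1.7, rendered without the `W^{1,q}` clauses)
implies the barrier fact `SharpLpLinftyNonuniqueness` (Thm. 1.6 with its proof: a second weak
solution with the same datum, of zero mean, in `L^p_t L^∞_x`, not a.e. equal to the given one
and not Leray–Hopf). See the module docstring for the architecture; the constants are `ε = 1`,
the gluing time `a = (a₀ + b)/2` inside the interval of regularity `[a₀, b]`, `δ = (b - a₀)/8`,
the late interval `J = (3δ, T - a)` of length `L`, and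
`K = (B + L + 2)/(‖W‖₂ L)` with `B = max (T + ‖u‖²_{L²ₜₓ}) ((1 + ‖u₀‖₂²) L)`.
[cite: CheskidovLuo2022, Thm. 1.6, Thm. 1.7 and §2.6 (proof of Thm. 1.6)] -/
theorem SharpLpLinftyNonuniqueness_of_mainTheorem (h17 : CheskidovLuo2022MainTheorem) :
    SharpLpLinftyNonuniqueness := by
  intro n hn T hT p hp1 hp2 u₀ u hu₀ hu₀div hu₀mean hu humean huLp hreg
  obtain ⟨a₀, b, ha₀, ha₀b, hbT, husm⟩ := hreg
  /- Step 0: the gluing time `a`, the margin `δ`, the residual length `T' = T - a`. -/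
  set a : ℝ := (a₀ + b) / 2 with ha_def
  set δ : ℝ := (b - a₀) / 8 with hδ_def
  have hδ : 0 < δ := by rw [hδ_def]; linarith
  have ha₀a : a₀ < a := by rw [ha_def]; linarith
  have hab : a < b := by rw [ha_def]; linarith
  have hab4 : a + 4 * δ = b := by rw [ha_def, hδ_def]; ring
  have ha0 : 0 < a := lt_of_le_of_lt ha₀ ha₀a
  have haT : a < T := lt_of_lt_of_le hab hbT
  set T' : ℝ := T - a with hT'_def
  have hT' : 0 < T' := by rw [hT'_def]; linarith
  have h4δ : 4 * δ ≤ T' := by rw [hT'_def]; linarith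
  /- Step 1: slab facts for `u` on `[a₀, b]`. -/
  have hcont : ContinuousOn (Torus.stLift u) (Icc a₀ b ×ˢ univ) := husm.continuousOn_stLift
  have hae_slab : ∀ {P : ((UnitAddTorus (Fin n)) → EuclideanSpace ℝ (Fin n)) → Prop}, (∀ᵐ t ∂(volume.restrict (Ioo 0 T)), P (u t)) →
      ∀ᵐ t ∂(volume.restrict (Icc a₀ b)), P (u t) := by
    intro P h
    have h1 : ∀ᵐ t ∂(volume.restrict (Ioo a₀ b)), P (u t) :=
      ae_restrict_of_ae_restrict_of_subset (Ioo_subset_Ioo ha₀ hbT) h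
    rwa [Measure.restrict_congr_set Ioo_ae_eq_Icc] at h1
  have hdiv_slab : ∀ t ∈ Icc a₀ b, Torus.IsDivFree (u t) :=
    isDivFree_of_ae_of_isSmoothSpaceTimeOn ha₀b husm (hae_slab hu.2.2.1)
  have hmean_slab : ∀ t ∈ Icc a₀ b, Torus.HasZeroMean (u t) :=
    hasZeroMean_of_ae_of_isSmoothSpaceTimeOn ha₀b husm (hae_slab humean)
  /- Step 2: the translated field `s ↦ u (s + a)`, smooth on `[0, 4δ] × 𝕋ⁿ`. -/
  have husm' : Torus.IsSmoothSpaceTimeOn (Icc 0 (4 * δ)) (fun s => u (s + a)) := by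
    refine isSmoothSpaceTimeOn_comp_add_right (husm.mono fun t ht => ?_)
    exact ⟨by linarith [ht.1], by linarith [ht.2]⟩
  /- Step 3: the temporal cut-offs `θ` (`= 1` on `[0, δ]`, `= 0` after `2δ`) and `ζ`
  (`= 0` before `2δ`, `= 1` after `3δ`). -/
  obtain ⟨σ, hσ, hσ0, hσ1⟩ := FluidPDE.Torus.exists_smooth_step (show δ < 2 * δ by linarith)
  obtain ⟨ζ, hζ, hζ0, hζ1⟩ := FluidPDE.Torus.exists_smooth_step (show 2 * δ < 3 * δ by linarith)
  set θ : ℝ → ℝ := fun t => 1 - σ t with hθ_def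
  have hθ : ContDiff ℝ ∞ θ := contDiff_const.sub hσ
  have hθ1 : ∀ t ≤ δ, θ t = 1 := fun t ht => by simp [hθ_def, hσ0 t ht]
  have hθ0 : ∀ t, 2 * δ ≤ t → θ t = 0 := fun t ht => by simp [hθ_def, hσ1 t ht]
  /- Step 4: the shear mode `W = Re (e_{k} ⊗ e_{i₀})`, `k = e_{i₁}`, and the constants. -/
  have hn0 : 0 < n := by omega
  have hn1 : 1 < n := by omega
  set i₀ : Fin n := ⟨0, hn0⟩ with hi₀
  set i₁ : Fin n := ⟨1, hn1⟩ with hi₁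
  have hi01 : i₀ ≠ i₁ := by simp [hi₀, hi₁, Fin.ext_iff]
  set k : Fin n → ℤ := Pi.single i₁ 1 with hk_def
  set c : (Fin n → ℤ) → EuclideanSpace ℂ (Fin n) := fun _ => EuclideanSpace.single i₀ (1 : ℂ) with hc_def
  set W : (UnitAddTorus (Fin n)) → EuclideanSpace ℝ (Fin n) := Torus.realTrigPoly {k} c with hW_def
  have hk0 : k ≠ 0 := by
    intro h
    have h1 := congrFun h i₁
    simp [hk_def] at h1
  have hWsm : Torus.IsSmooth W := Torus.isSmooth_realTrigPoly _ _
  have hWdiv : Torus.IsDivFree W := by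
    refine Torus.isDivFree_realTrigPoly_singleton ?_
    simp only [hk_def, hc_def, PiLp.single_apply]
    rw [Finset.sum_eq_single i₀ (fun j _ hj => by simp [hj]) (fun h => absurd (Finset.mem_univ _) h)]
    simp [hi01]
  have hWmean : Torus.HasZeroMean W := hasZeroMean_realTrigPoly_singleton hk0 c
  have hWbd : ∀ x, ‖W x‖ ≤ 1 := fun x =>
    (Torus.norm_realTrigPoly_singleton_le k c x).trans (by simp [hc_def])
  have hW0 : W 0 ≠ 0 := by
    rw [hW_def, realTrigPoly_singleton_apply_zero]
    intro h
    have h1 := congrArg (fun v : EuclideanSpace ℝ (Fin n) => v i₀) h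
    simp [hc_def, EuclideanSpace.realPart_apply] at h1
  have hW2pos : 0 < eLpNorm W 2 volume :=
    eLpNorm_pos_of_continuous_of_ne_zero hWsm.continuous hW0 2 two_ne_zero
  have hWL2 : MemLp W 2 volume := Torus.memLp_realTrigPoly _ _ _
  have hWLinf : MemLp W ∞ volume := Torus.memLp_realTrigPoly _ _ _
  set W2 : ℝ := (eLpNorm W 2 volume).toReal with hW2_def
  have hW2 : 0 < W2 := ENNReal.toReal_pos hW2pos.ne' hWL2.eLpNorm_ne_top
  -- constants
  set E2 : ℝ := ∫ x, ‖u₀ x‖ ^ 2 with hE2_def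
  have hE2 : 0 ≤ E2 := integral_nonneg fun x => by positivity
  set Qe : ℝ≥0∞ := ∫⁻ t in Ioo 0 T, ∫⁻ x, ‖u t x‖ₑ ^ 2 with hQe_def
  have hQe : Qe < ⊤ := hu.2.1
  set Q : ℝ := Qe.toReal with hQ_def
  have hQ : 0 ≤ Q := ENNReal.toReal_nonneg
  set L : ℝ := T' - 3 * δ with hL_def
  have hL : 0 < L := by rw [hL_def]; linarith
  set B : ℝ := max (T + Q) ((1 + E2) * L) with hB_def
  have hB : 0 ≤ B := le_max_of_le_left (by linarith)
  set K : ℝ := (B + L + 2) / (W2 * L) with hK_def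
  have hK : 0 < K := by positivity
  have hKlt : B + L + 1 < K * (eLpNorm W 2 volume).toReal * L := by
    rw [← hW2_def, hK_def, mul_assoc, div_mul_cancel₀ _ (by positivity)]
    linarith
  /- Step 5: the field `ṽ` of §2.6 on `[0, T'] × 𝕋ⁿ`. -/
  set vt : ℝ → (UnitAddTorus (Fin n)) → EuclideanSpace ℝ (Fin n) := fun s x => θ s • u (s + a) x + (K * ζ s) • W x with hvt_def
  -- the first summand, slice-wise
  have hslab_of_lt : ∀ s, 0 ≤ s → s < 2 * δ → s + a ∈ Icc a₀ b := fun s hs0 hs =>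
    ⟨by linarith, by linarith⟩
  have hfirst : ∀ s ∈ Icc 0 T', Torus.IsSmooth (fun x => θ s • u (s + a) x) ∧
      Torus.IsDivFree (fun x => θ s • u (s + a) x) ∧ Torus.HasZeroMean (fun x => θ s • u (s + a) x) := by
    intro s hs
    by_cases h2 : 2 * δ ≤ s
    · have hz : (fun x => θ s • u (s + a) x) = fun _ => (0 : EuclideanSpace ℝ (Fin n)) := by
        funext x
        simp [hθ0 s h2]
      rw [hz]
      refine ⟨Torus.isSmooth_const _, fun x => ?_, by simp [Torus.HasZeroMean]⟩
      have h0 : Torus.divergence (fun _ : UnitAddTorus (Fin n) => (0 : EuclideanSpace ℝ (Fin n))) x =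
          Torus.divergence (fun y : UnitAddTorus (Fin n) => (0 : ℝ) • (0 : EuclideanSpace ℝ (Fin n))) x := by simp
      rw [h0, FluidPDE.Torus.divergence_fun_const_smul, zero_mul]
    · have hsa : s + a ∈ Icc a₀ b := hslab_of_lt s hs.1 (lt_of_not_ge h2)
      have hsm : Torus.IsSmooth (u (s + a)) := husm.isSmooth_slice hsa
      refine ⟨hsm.smul (θ s), fun x => ?_, ?_⟩
      · rw [FluidPDE.Torus.divergence_fun_const_smul, hdiv_slab _ hsa x, mul_zero]
      · exact FluidPDE.Torus.hasZeroMean_const_smul (hmean_slab _ hsa) (θ s)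
  have hvt_sm : Torus.IsSmoothSpaceTimeOn (Icc 0 T') vt := by
    have h1 : Torus.IsSmoothSpaceTimeOn (Icc 0 T') (fun s x => θ s • u (s + a) x) :=
      FluidPDE.Torus.IsTimeCutoff.isSmoothSpaceTimeOn_smul (S := Icc 0 T') (a := 0) (b := 4 * δ)
        ⟨hθ, Or.inl fun t ht => ht.1, Or.inr ⟨2 * δ, by linarith, fun t ht => hθ0 t ht⟩⟩ husm'
    have h2 : Torus.IsSmoothSpaceTimeOn (Icc 0 T') (fun s x => (K * ζ s) • W x) := by
      change ContDiffOn ℝ ∞ (Torus.stLift fun s x => (K * ζ s) • W x) (Icc 0 T' ×ˢ univ)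
      have h : Torus.stLift (fun s x => (K * ζ s) • W x) =
          fun q : ℝ × EuclideanSpace ℝ (Fin n) => (K * ζ q.1) • Torus.lift W q.2 := by
        funext q
        rfl
      rw [h]
      exact ((contDiff_const.mul (hζ.comp contDiff_fst)).smul
        ((hWsm : ContDiff ℝ ∞ (Torus.lift W)).comp contDiff_snd)).contDiffOn
    exact h1.add h2
  have hvt_div : ∀ s ∈ Icc 0 T', Torus.IsDivFree (vt s) := by
    intro s hs
    obtain ⟨hsm1, hdiv1, -⟩ := hfirst s hs
    have h : vt s = fun x => θ s • u (s + a) x + (K * ζ s) • W x := rfl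
    rw [h]
    refine Torus.IsDivFree.add (hsm1.isContDiff (by simp)) ((hWsm.smul _).isContDiff (by simp)) hdiv1 ?_
    intro x
    rw [FluidPDE.Torus.divergence_fun_const_smul, hWdiv x, mul_zero]
  have hvt_mean : ∀ s ∈ Icc 0 T', Torus.HasZeroMean (vt s) := by
    intro s hs
    obtain ⟨hsm1, -, hmean1⟩ := hfirst s hs
    have h : vt s = fun x => θ s • u (s + a) x + (K * ζ s) • W x := rfl
    rw [h]
    exact Torus.HasZeroMean.add hmean1 (FluidPDE.Torus.hasZeroMean_const_smul hWmean _)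
      hsm1.continuous.integrable_unitAddTorus (hWsm.continuous.const_smul (K * ζ s)).integrable_unitAddTorus
  have hvt0 : vt 0 = u a := by
    funext x
    simp [hvt_def, hθ1 0 hδ.le, hζ0 0 (by linarith)]
  have hvt_late : ∀ s, 3 * δ ≤ s → vt s = K • W := by
    intro s hs
    funext x
    simp [hvt_def, hθ0 s (by linarith), hζ1 s hs]
  /- Step 6: Thm. 1.7 applied to `ṽ` on `[0, T']` with `ε = 1`. -/
  obtain ⟨w, hw, hwmean, hwLp, -, -, hclose⟩ := h17 n hn T' hT' p hp1 hp2 1 one_pos vt hvt_sm hvt_div hvt_mean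
  rw [hvt0] at hw
  /- Step 7: the glued field. -/
  set U : ℝ → (UnitAddTorus (Fin n)) → EuclideanSpace ℝ (Fin n) := fun t => if t ≤ a then u t else w (t - a) with hU_def
  have hUw : FunctionSpaces.Torus.IsWeakNSSolutionWithDataOn T 1 u₀ U :=
    hu.glue ha0 haT ⟨ha₀a, hab⟩ hcont hw
  have hUmean : ∀ᵐ t ∂(volume.restrict (Ioo 0 T)), Torus.HasZeroMean (U t) :=
    FluidPDE.Torus.ae_restrict_glue (P := Torus.HasZeroMean) ha0 haT humean hwmean
  have hULp : FluidPDE.Torus.MemLqLp (ENNReal.ofReal p) ∞ U (Ioo 0 T) :=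
    FluidPDE.Torus.memLqLp_glue ha0 haT huLp hwLp
  -- the late interval `J = (3δ, T')` and the common data of the two contradictions
  set J : Set ℝ := Ioo (3 * δ) T' with hJ_def
  have hJT' : J ⊆ Ioo 0 T' := Ioo_subset_Ioo (by linarith) le_rfl
  have hJvol : volume J = ENNReal.ofReal L := by rw [hJ_def, Real.volume_Ioo]
  have hp0 : 0 < p := by linarith
  have hguard : ∀ᵐ s ∂(volume.restrict J), MemLp (w s) ∞ volume :=
    ae_restrict_of_ae_restrict_of_subset hJT' hwLp.1
  have hwm : AEMeasurable (fun s => eLpNorm (w s) 2 volume) (volume.restrict J) :=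
    aemeasurable_eLpNorm_two_slice
      (hw.1.mono_measure (Measure.restrict_mono (prod_mono hJT' subset_rfl) le_rfl))
  have hclose' : ∫⁻ s in J, ‖(eLpNorm (w s - K • W) ∞ volume).toReal‖ₑ ^ p ≤ 1 := by
    -- unfold the mixed norm in the closeness clause
    have hq0 : ENNReal.ofReal p ≠ 0 := (ENNReal.ofReal_pos.2 hp0).ne'
    have h1 : ∫⁻ s in Ioo 0 T', ‖(eLpNorm ((w - vt) s) ∞ volume).toReal‖ₑ ^ p ≤ 1 := by
      have h := hclose
      rw [FluidPDE.Torus.eLqLpNorm, FluidPDE.eLqLpNorm, eLpNorm_eq_lintegral_rpow_enorm_toReal hq0 ENNReal.ofReal_ne_top,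
        ENNReal.toReal_ofReal hp0.le, ENNReal.ofReal_one] at h
      have h2 := ENNReal.rpow_le_rpow h hp0.le
      rwa [ENNReal.one_rpow, ← ENNReal.rpow_mul, one_div, inv_mul_cancel₀ hp0.ne', ENNReal.rpow_one] at h2
    calc ∫⁻ s in J, ‖(eLpNorm (w s - K • W) ∞ volume).toReal‖ₑ ^ p
        = ∫⁻ s in J, ‖(eLpNorm ((w - vt) s) ∞ volume).toReal‖ₑ ^ p :=
          setLIntegral_congr_fun measurableSet_Ioo fun s hs => by
            rw [Pi.sub_apply, hvt_late s hs.1.le]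
      _ ≤ ∫⁻ s in Ioo 0 T', ‖(eLpNorm ((w - vt) s) ∞ volume).toReal‖ₑ ^ p := lintegral_mono_set hJT'
      _ ≤ 1 := h1
  refine ⟨U, hUw, hUmean, hULp, fun hD => ?_, fun hLH => ?_⟩
  · /- Distinctness: if `U = u` a.e., then `∫⁻_J ‖w(s)‖₂ ≤ T + ‖u‖²_{L²ₜₓ}`. -/
    have hD' : ∀ᵐ s ∂(volume.restrict J), eLpNorm (w s) 2 volume = eLpNorm (u (s + a)) 2 volume := by
      have h1 : ∀ᵐ t ∂(volume.restrict (Ioo (3 * δ + a) (T' + a))), U t =ᵐ[volume] u t :=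
        ae_restrict_of_ae_restrict_of_subset (Ioo_subset_Ioo (by linarith) (by rw [hT'_def]; linarith)) hD
      have h2 := ae_restrict_Ioo_comp_add_right (P := fun t => U t =ᵐ[volume] u t) h1
      filter_upwards [h2, ae_restrict_mem measurableSet_Ioo] with s hs hsJ
      have hsa : ¬ (s + a ≤ a) := by
        intro h
        linarith [hsJ.1, hδ]
      have hUs : U (s + a) = w s := by
        simp [hU_def, hsa]
      rw [← hUs]
      exact eLpNorm_congr_ae hs
    have hbound : ∫⁻ s in J, eLpNorm (w s) 2 volume ≤ ENNReal.ofReal B := by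
      calc ∫⁻ s in J, eLpNorm (w s) 2 volume = ∫⁻ s in J, eLpNorm (u (s + a)) 2 volume :=
            lintegral_congr_ae hD'
        _ = ∫⁻ t in Ioo (3 * δ + a) (T' + a), eLpNorm (u t) 2 volume :=
            setLIntegral_Ioo_comp_add_right (fun t => eLpNorm (u t) 2 volume) _ _ _
        _ ≤ ∫⁻ t in Ioo 0 T, eLpNorm (u t) 2 volume :=
            lintegral_mono_set (Ioo_subset_Ioo (by linarith) (by rw [hT'_def]; linarith))
        _ ≤ ∫⁻ t in Ioo 0 T, (1 + eLpNorm (u t) 2 volume ^ (2 : ℝ)) :=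
            lintegral_mono fun t => ennreal_le_one_add_rpow _ one_le_two
        _ = volume (Ioo (0 : ℝ) T) + ∫⁻ t in Ioo 0 T, ∫⁻ x, ‖u t x‖ₑ ^ 2 := by
            rw [lintegral_add_left measurable_const, setLIntegral_const, one_mul]
            congr 1
            exact lintegral_congr fun t => eLpNorm_two_rpow_two _
        _ = ENNReal.ofReal (T + Q) := by
            rw [Real.volume_Ioo, sub_zero, hQ_def, ENNReal.ofReal_add hT.le ENNReal.toReal_nonneg,
              ENNReal.ofReal_toReal hQe.ne]
        _ ≤ ENNReal.ofReal B := ENNReal.ofReal_le_ofReal (le_max_left _ _)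
    exact core_contradiction hp1 hK.le hL.le hB hJvol hWLinf hWL2.eLpNorm_ne_top hwm hguard hclose' hbound hKlt
  · /- Not Leray–Hopf: the energy inequality gives `∫‖w(s)‖² ≤ ∫‖u₀‖²` for every `s ∈ J`. -/
    have hE : ∀ s ∈ J, eLpNorm (w s) 2 volume ≤ ENNReal.ofReal (1 + E2) := by
      intro s hs
      have hs0 : 0 < s := lt_trans (by linarith) hs.1
      have hsaT : s + a ∈ Icc 0 T := ⟨by linarith, by linarith [hs.2, hT'_def]⟩
      have hsa : ¬ (s + a ≤ a) := by intro h; linarith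
      have hUs : U (s + a) = w s := by simp [hU_def, hsa]
      have hmem : MemLp (w s) 2 volume := by
        have h := hLH.memLp (s + a) hsaT
        rwa [hUs] at h
      have hen := hLH.energy_ineq_zero (s + a) hsaT
      rw [hUs] at hen
      have hdiss : 0 ≤ (1 : ℝ) * (∫⁻ τ in Ioo 0 (s + a), FunctionSpaces.Torus.eGradNormSq (U τ)).toReal :=
        by positivity
      have hforce : ∫ τ in (0 : ℝ)..(s + a), ∫ x, ⟪(0 : ℝ → (UnitAddTorus (Fin n)) → EuclideanSpace ℝ (Fin n)) τ x, U τ x⟫_ℝ = 0 := by simp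
      rw [hforce, add_zero] at hen
      have hke : FunctionSpaces.Torus.kineticEnergy (w s) ≤ FunctionSpaces.Torus.kineticEnergy u₀ := by linarith
      simp only [FunctionSpaces.Torus.kineticEnergy] at hke
      have hint : ∫ x, ‖w s x‖ ^ 2 ≤ E2 := by
        rw [hE2_def]
        linarith
      have hsq : eLpNorm (w s) 2 volume ^ (2 : ℝ) ≤ ENNReal.ofReal E2 := by
        rw [eLpNorm_two_rpow_two, FluidPDE.Torus.lintegral_enorm_sq_eq_ofReal hmem]
        exact ENNReal.ofReal_le_ofReal hint
      calc eLpNorm (w s) 2 volume ≤ 1 + eLpNorm (w s) 2 volume ^ (2 : ℝ) := ennreal_le_one_add_rpow _ one_le_two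
        _ ≤ 1 + ENNReal.ofReal E2 := add_le_add le_rfl hsq
        _ = ENNReal.ofReal (1 + E2) := by rw [ENNReal.ofReal_add zero_le_one hE2, ENNReal.ofReal_one]
    have hbound : ∫⁻ s in J, eLpNorm (w s) 2 volume ≤ ENNReal.ofReal B := by
      calc ∫⁻ s in J, eLpNorm (w s) 2 volume ≤ ∫⁻ _ in J, ENNReal.ofReal (1 + E2) := by
            refine lintegral_mono_ae ?_
            filter_upwards [ae_restrict_mem measurableSet_Ioo] with s hs
            exact hE s hs
        _ = ENNReal.ofReal ((1 + E2) * L) := by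
            rw [setLIntegral_const, hJvol, ← ENNReal.ofReal_mul (by linarith)]
        _ ≤ ENNReal.ofReal B := ENNReal.ofReal_le_ofReal (le_max_right _ _)
    exact core_contradiction hp1 hK.le hL.le hB hJvol hWLinf hWL2.eLpNorm_ne_top hwm hguard hclose' hbound hKlt

end Assembly

/-! ## Thm. 1.6 from the convex-integration step Prop. 4.1 -/

section Reduction

/-- **Cheskidov–Luo 2022, Thm. 1.6 from Prop. 4.1 alone.** The chain of printed deductions
Thm. 1.6 ⇐ Thm. 1.7 (§2.6, `SharpLpLinftyNonuniqueness_of_mainTheorem`) ⇐ Prop. 2.2 (§2.6,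
`CheskidovLuo2022MainTheorem_of_mainIteration`) ⇐ Prop. 3.1 ∧ Prop. 4.1 (§4,
`Torus.CheskidovLuo2022MainIteration_of_steps`), with Prop. 3.1 ⇐ the corrector construction of
§3.1/Prop. 3.2 (`Torus.CheskidovLuo2022Concentration_of_corrector`,
`Torus.CheskidovLuo2022Corrector_holds`, all proved), leaves exactly the convex-integration step
Prop. 4.1 (`Torus.CheskidovLuo2022ConvexIntegration`, §§4–5): if it holds on `𝕋ⁿ` for every `n`
(its statement is guarded by `2 ≤ card (Fin n)`), then the sharp `L^p_t L^∞_x` nonuniqueness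
Thm. 1.6 holds. [cite: CheskidovLuo2022, Thm. 1.6, Thm. 1.7, Prop. 2.2, Prop. 3.1, Prop. 4.1] -/
theorem SharpLpLinftyNonuniqueness_of_convexIntegration
    (h41 : ∀ n : ℕ, FluidPDE.Torus.CheskidovLuo2022ConvexIntegration (d := Fin n)) :
    SharpLpLinftyNonuniqueness :=
  SharpLpLinftyNonuniqueness_of_mainTheorem <|
    CheskidovLuo2022MainTheorem_of_mainIteration fun n =>
      FluidPDE.Torus.CheskidovLuo2022MainIteration_of_steps
        (FluidPDE.Torus.CheskidovLuo2022Concentration_of_corrector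
          FluidPDE.Torus.CheskidovLuo2022Corrector_holds)
        (h41 n)

end Reduction

/-! ## The discharge: Thm. 1.6 proved -/

section Discharge

/-- **Cheskidov–Luo 2022, Thm. 1.6 (sharp `L^p_t L^∞_x` nonuniqueness), PROVED.** A weak solution
of the Navier–Stokes equations on `𝕋ⁿ` (`n ≥ 2`) in `L^p_t L^∞_x`, `1 ≤ p < 2`, with an interval
of regularity is not unique in that class: there is a second weak solution with the same datum, of
zero mean and in `L^p_t L^∞_x`, not a.e. equal to it and not Leray–Hopf. The printed chain
Thm. 1.6 ⇐ Thm. 1.7 (§2.6) ⇐ Prop. 2.2 ⇐ Prop. 3.1 ∧ Prop. 4.1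
(`SharpLpLinftyNonuniqueness_of_convexIntegration`) is closed by the proved
convex-integration step `Torus.CheskidovLuo2022ConvexIntegration_holds` (Prop. 4.1, §§4–5, file
`Literature/Analysis/FluidPDE/CLConvexIntegration`) in every dimension `Fin n`.
[cite: CheskidovLuo2022, Thm. 1.6; proof §2.6, Thm. 1.7, Prop. 2.2, Prop. 3.1, Prop. 4.1] -/
theorem SharpLpLinftyNonuniqueness_holds : SharpLpLinftyNonuniqueness :=
  SharpLpLinftyNonuniqueness_of_convexIntegration fun _ =>
    FluidPDE.Torus.CheskidovLuo2022ConvexIntegration_holds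

end Discharge

end Literature.Barriers.NavierStokesRegularity
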